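import Literature.Topology.FourManifolds.GaussDiagrams
import Literature.Topology.FourManifolds.ConnectedSumNormalForm
import Literature.Topology.FourManifolds.KnotsProofs
import HarnessLib

/-!
# The mirror image of a knot has the mirrored Gauss diagram, up to isotopy (discharge of `Knot.HasGaussDiagram.mirror`)

Third sibling proof file of `GaussDiagrams.lean` (next to `GaussDiagramsProofs.lean` and
`GaussDiagramsReverseProofs.lean`; D-0014: named facts `def X : Prop` are discharged as
`theorem X_holds : X`). It proves the named fact
`Literature.Topology.FourManifolds.Knot.HasGaussDiagram.mirror`
(`Knot.HasGaussDiagram.mirror_holds`): if a knot `K` has a regular projection reading the Gauss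
diagram `G`, then its mirror image `K.mirror = reflectLast 3 ∘ K` (reflection of `𝕊 3` in the last
coordinate `x₃`) is isotopic to a knot reading `G.mirror` (all arrows reversed — over- and
under-passages exchanged — and all signs negated).

M. Goussarov, M. Polyak, O. Viro, *Finite-type invariants of classical and virtual knots*,
Topology 39 (2000) 1045–1068, §1.1 (arXiv:math/9810073): the Gauss diagram of a knot diagram is
the parametrising circle with the two preimages of each double point joined by a chord oriented
from the over-passage to the under-passage and decorated with the local writhe. The mirror image of
a knot *diagram* (all crossings switched; D. Rolfsen, *Knots and Links* (1976), §3.C, "obverse";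
L. Kauffman, *On Knots* (1987), Ch. II) is the diagram of the knot reflected **in the projection
plane**, i.e. in the height coordinate: the plane curve is unchanged, at every double point the
upper and the lower strand are exchanged (so every chord is reversed) and the local writhe
`sign det (γ'(over), γ'(under))` changes sign (the two rows are exchanged). As the docstring of the
fact records, the LITERAL mirror `K.mirror` of `Knots.lean` reflects the coordinate `x₃` of
`𝕊 3 ⊂ ℝ⁴` (the axis of the stereographic projection), not the height `x₂`; the two reflections
differ by the half-turn `rot_π` of `𝕊 3` in the `(x₂, x₃)`-plane, which is isotopic to the identity
through the rotations `rot_{πt}` (`rotLastTwoIsotopy`, `halfTurn`,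
`SphereEmbedding.isIsotopic_map_halfTurn` of `ConnectedSumNormalForm.lean`). Hence
`K' := rot_π ∘ reflectLast 3 ∘ K = (x₀, x₁, -x₂, x₃) ∘ K` is isotopic to `K.mirror`, has the same
plane curve as `K` and the opposite height function (`Knot.planeCurve_mirrorTurn`,
`Knot.heightCurve_mirrorTurn`), and the parameters `θ` of a regular projection `P` of `K` satisfy
every axiom of a regular projection of `K'` with diagram `P.diagram.mirror`
(`Knot.RegularProjection.hasGaussDiagram_mirrorTurn`). (No appeal to Cerf's theorem on
orientation-reversing diffeomorphisms of `S³` is needed: the specific isotopy is a rotation.)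

Nothing here is new mathematics; no definitions and no named facts are introduced. The
`[SphereEmbedding.SmoothnessFacts]` argument of `Knot.mirror` is the instance
`SphereEmbedding.smoothnessFacts` of `KnotsProofs.lean`.

## References

* M. Goussarov, M. Polyak, O. Viro, *Finite-type invariants of classical and virtual knots*,
  Topology 39 (2000) 1045–1068, §1.1 and §1.4; arXiv:math/9810073. [cite: GPV2000, §1.1]
* D. Rolfsen, *Knots and Links*, Publish or Perish (1976), §3.C (obverse and reverse).
  [cite: Rolfsen1976, §3.C]
* L. H. Kauffman, *On Knots*, Annals of Math. Studies 115 (1987), Ch. II (mirror image: all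
  crossings switched, writhe negated). [cite: Kauffman1987, Ch. II]
-/

open scoped Manifold ContDiff Topology
open Function Set

noncomputable section

namespace Literature.Topology.FourManifolds

namespace GaussDiagram

/- The four bookkeeping lemmas below are local (`private`, pointwise) forms of the `simp` lemmas
`GaussDiagram.mirror_n`, `mirror_overPos`, `mirror_underPos`, `mirror_sign` of
`LeeRasmussenMirrorProofs.lean`, restated so that this geometric file does not import the
Khovanov–Lee machinery. -/

/-- The mirror image keeps the number of chords. [folklore] -/
private theorem n_mirror (G : GaussDiagram) : G.mirror.n = G.n := rfl

/-- In the mirror image the over-passage of chord `i` is the old under-passage. [folklore] -/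
private theorem overPos_mirror_apply (G : GaussDiagram) (i : Fin G.n) : G.mirror.overPos i = G.underPos i := rfl

/-- In the mirror image the under-passage of chord `i` is the old over-passage. [folklore] -/
private theorem underPos_mirror_apply (G : GaussDiagram) (i : Fin G.n) : G.mirror.underPos i = G.overPos i :=
  rfl

/-- The mirror image negates every sign (local writhe). Kauffman (1987), Ch. II. [cite: Kauffman1987, Ch. II] -/
private theorem sign_mirror_apply (G : GaussDiagram) (i : Fin G.n) : G.mirror.sign i = -G.sign i := rfl

end GaussDiagram

/-! ## The reflection in the height coordinate: `rot_π ∘ reflectLast 3 = (x₀, x₁, -x₂, x₃)` -/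

/-- The half-turn after the reflection in `x₃` keeps the coordinate `x₀`. [folklore] -/
theorem halfTurn_reflectLast_apply_zero (y : Metric.sphere (0 : EuclideanSpace ℝ (Fin 4)) 1) :
    ((halfTurn (reflectLast 3 y) : Metric.sphere (0 : EuclideanSpace ℝ (Fin 4)) 1) : EuclideanSpace ℝ (Fin 4)) 0
      = (y : EuclideanSpace ℝ (Fin 4)) 0 := by
  rw [halfTurn, coe_rotLastTwoDiffeo, coe_rotLastTwo, rotLastTwoAux_apply_zero]
  exact reflectLast_apply_of_ne_last 3 y (by decide)

/-- The half-turn after the reflection in `x₃` keeps the coordinate `x₁`. [folklore] -/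
theorem halfTurn_reflectLast_apply_one (y : Metric.sphere (0 : EuclideanSpace ℝ (Fin 4)) 1) :
    ((halfTurn (reflectLast 3 y) : Metric.sphere (0 : EuclideanSpace ℝ (Fin 4)) 1) : EuclideanSpace ℝ (Fin 4)) 1
      = (y : EuclideanSpace ℝ (Fin 4)) 1 := by
  rw [halfTurn, coe_rotLastTwoDiffeo, coe_rotLastTwo, rotLastTwoAux_apply_one]
  exact reflectLast_apply_of_ne_last 3 y (by decide)

/-- The half-turn after the reflection in `x₃` negates the height coordinate `x₂`. [folklore] -/
theorem halfTurn_reflectLast_apply_two (y : Metric.sphere (0 : EuclideanSpace ℝ (Fin 4)) 1) :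
    ((halfTurn (reflectLast 3 y) : Metric.sphere (0 : EuclideanSpace ℝ (Fin 4)) 1) : EuclideanSpace ℝ (Fin 4)) 2
      = -(y : EuclideanSpace ℝ (Fin 4)) 2 := by
  rw [halfTurn_apply_two]
  exact congrArg Neg.neg (reflectLast_apply_of_ne_last 3 y (by decide))

/-- The half-turn after the reflection in `x₃` keeps the coordinate `x₃` (both negate it).
[folklore] -/
theorem halfTurn_reflectLast_apply_three (y : Metric.sphere (0 : EuclideanSpace ℝ (Fin 4)) 1) :
    ((halfTurn (reflectLast 3 y) : Metric.sphere (0 : EuclideanSpace ℝ (Fin 4)) 1) : EuclideanSpace ℝ (Fin 4)) 3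
      = (y : EuclideanSpace ℝ (Fin 4)) 3 := by
  rw [show (3 : Fin 4) = Fin.last 3 from rfl, halfTurn_apply_last, reflectLast_apply_last, neg_neg]

/-- The reflection in the height coordinate does not change the planar (stereographic)
projection, which only involves `x₀, x₁, x₃`. [folklore] -/
theorem planarProjection_halfTurn_reflectLast (y : Metric.sphere (0 : EuclideanSpace ℝ (Fin 4)) 1) :
    planarProjection (halfTurn (reflectLast 3 y)) = planarProjection y := by
  simp only [planarProjection, halfTurn_reflectLast_apply_zero, halfTurn_reflectLast_apply_one,
    halfTurn_reflectLast_apply_three]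

/-- The reflection in the height coordinate negates the height over the projection plane.
[folklore] -/
theorem height_halfTurn_reflectLast (y : Metric.sphere (0 : EuclideanSpace ℝ (Fin 4)) 1) :
    height (halfTurn (reflectLast 3 y)) = -height y := by
  simp only [height, halfTurn_reflectLast_apply_two, halfTurn_reflectLast_apply_three, mul_neg]

/-- The height coordinate `x₂` of the north pole `(0, 0, 0, 1)` vanishes. [folklore] -/
theorem northPole_apply_two :
    ((northPole : Metric.sphere (0 : EuclideanSpace ℝ (Fin 4)) 1) : EuclideanSpace ℝ (Fin 4)) 2 = 0 := by
  simp [coe_northPole]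

/-- The reflection in the height coordinate fixes only what it should: if it sends `y` to the
north pole (the centre of projection) then `y` is the north pole. [folklore] -/
theorem eq_northPole_of_halfTurn_reflectLast_eq {y : Metric.sphere (0 : EuclideanSpace ℝ (Fin 4)) 1}
    (h : halfTurn (reflectLast 3 y) = northPole) : y = northPole := by
  have h0 := halfTurn_reflectLast_apply_zero y
  have h1 := halfTurn_reflectLast_apply_one y
  have h2 := halfTurn_reflectLast_apply_two y
  have h3 := halfTurn_reflectLast_apply_three y
  rw [h] at h0 h1 h2 h3
  rw [northPole_apply_two] at h2
  apply Subtype.ext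
  ext i
  fin_cases i
  · exact h0.symm
  · exact h1.symm
  · show (y : EuclideanSpace ℝ (Fin 4)) 2 =
      ((northPole : Metric.sphere (0 : EuclideanSpace ℝ (Fin 4)) 1) : EuclideanSpace ℝ (Fin 4)) 2
    rw [northPole_apply_two]
    linarith
  · exact h3.symm

namespace Knot

variable [SphereEmbedding.SmoothnessFacts]

/-- The knot `rot_π ∘ reflectLast 3 ∘ K = (x₀, x₁, -x₂, x₃) ∘ K`, the mirror image of `K` in the
height coordinate, evaluated at a point. [folklore] -/
theorem mirror_map_halfTurn_apply (K : Knot) (x : Metric.sphere (0 : EuclideanSpace ℝ (Fin 2)) 1) :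
    (K.mirror.map halfTurn) x = halfTurn (reflectLast 3 (K x)) := rfl

/-- The mirror image in the height coordinate has the same plane curve. GPV (2000), §1.4;
Kauffman (1987), Ch. II. [cite: GPV2000, §1.4] -/
theorem planeCurve_mirrorTurn (K : Knot) : Knot.planeCurve (K.mirror.map halfTurn) = K.planeCurve := by
  funext t
  rw [planeCurve, planeCurve, mirror_map_halfTurn_apply, planarProjection_halfTurn_reflectLast]

/-- The mirror image in the height coordinate has the opposite height function. GPV (2000), §1.4;
Kauffman (1987), Ch. II. [cite: GPV2000, §1.4] -/
theorem heightCurve_mirrorTurn (K : Knot) (t : ℝ) :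
    Knot.heightCurve (K.mirror.map halfTurn) t = -K.heightCurve t := by
  rw [heightCurve, heightCurve, mirror_map_halfTurn_apply, height_halfTurn_reflectLast]

/-- The mirror image in the height coordinate misses the north pole if `K` does. [folklore] -/
theorem northPole_notMem_range_mirrorTurn {K : Knot} (h : northPole ∉ range K) :
    northPole ∉ range (K.mirror.map halfTurn) := by
  rintro ⟨x, hx⟩
  exact h ⟨x, eq_northPole_of_halfTurn_reflectLast_eq hx⟩

namespace RegularProjection

variable {K : Knot} (P : K.RegularProjection)

/-- **The mirrored regular projection.** If `P` is a regular projection of `K` reading the Gauss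
diagram `P.diagram`, then the same parameters `θ` read on the knot reflected in the height
coordinate, `rot_π ∘ reflectLast 3 ∘ K`, form a regular projection reading `P.diagram.mirror`: the
plane curve is unchanged, so double points and their transversality are the same; heights are
negated, so at each double point the roles of over- and under-passage are exchanged; and the
local writhe `sign det (γ'(over), γ'(under))` changes sign because the two rows are exchanged.
GPV (2000), §1.1 and §1.4; Kauffman (1987), Ch. II. [cite: GPV2000, §1.1] -/
theorem hasGaussDiagram_mirrorTurn :
    Knot.HasGaussDiagram (K.mirror.map halfTurn) P.diagram.mirror := by
  refine ⟨{ diagram := P.diagram.mirror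
            θ := P.θ
            strictMono := P.strictMono
            lt_add_two_pi := P.lt_add_two_pi
            northPole_notMem := northPole_notMem_range_mirrorTurn P.northPole_notMem
            deriv_ne_zero := fun t ↦ ?_
            double := fun i ↦ ?_
            eq_or_crossing := fun s t hst ↦ ?_
            heightCurve_lt := fun i ↦ ?_
            sign_eq := fun i ↦ ?_ }, rfl⟩
  · -- immersion: same plane curve
    rw [planeCurve_mirrorTurn]
    exact P.deriv_ne_zero t
  · -- double points: the same pair of passages, read in the other order
    show Knot.planeCurve (K.mirror.map halfTurn) (P.θ (P.diagram.mirror.overPos i)) =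
      Knot.planeCurve (K.mirror.map halfTurn) (P.θ (P.diagram.mirror.underPos i))
    rw [planeCurve_mirrorTurn, P.diagram.overPos_mirror_apply, P.diagram.underPos_mirror_apply]
    exact (P.double i).symm
  · -- no other multiple points
    show (∃ k : ℤ, t = s + k * (2 * Real.pi)) ∨
      ∃ (i : Fin P.diagram.n) (k l : ℤ), ({s + k * (2 * Real.pi), t + l * (2 * Real.pi)} : Set ℝ)
        = {P.θ (P.diagram.mirror.overPos i), P.θ (P.diagram.mirror.underPos i)}
    rw [planeCurve_mirrorTurn] at hst
    rcases P.eq_or_crossing s t hst with h | ⟨i, k, l, h⟩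
    · exact .inl h
    · refine .inr ⟨i, k, l, ?_⟩
      rw [P.diagram.overPos_mirror_apply, P.diagram.underPos_mirror_apply, h, pair_comm]
  · -- heights are negated, so over and under are exchanged
    show Knot.heightCurve (K.mirror.map halfTurn) (P.θ (P.diagram.mirror.underPos i)) <
      Knot.heightCurve (K.mirror.map halfTurn) (P.θ (P.diagram.mirror.overPos i))
    rw [heightCurve_mirrorTurn, heightCurve_mirrorTurn, P.diagram.overPos_mirror_apply,
      P.diagram.underPos_mirror_apply, neg_lt_neg_iff]
    exact P.heightCurve_lt i
  · -- signs: the two rows of the determinant are exchanged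
    show ((P.diagram.mirror.sign i : ℤˣ) : ℤ) = SignType.sign (Matrix.det
      !![(deriv (Knot.planeCurve (K.mirror.map halfTurn)) (P.θ (P.diagram.mirror.overPos i))).1,
          (deriv (Knot.planeCurve (K.mirror.map halfTurn)) (P.θ (P.diagram.mirror.overPos i))).2;
         (deriv (Knot.planeCurve (K.mirror.map halfTurn)) (P.θ (P.diagram.mirror.underPos i))).1,
          (deriv (Knot.planeCurve (K.mirror.map halfTurn)) (P.θ (P.diagram.mirror.underPos i))).2])
    rw [planeCurve_mirrorTurn, P.diagram.overPos_mirror_apply, P.diagram.underPos_mirror_apply,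
      P.diagram.sign_mirror_apply, Units.val_neg, P.sign_eq i, Matrix.det_fin_two_of,
      Matrix.det_fin_two_of, ← SignType.coe_neg, ← Left.sign_neg]
    congr 2
    ring

end RegularProjection

omit [SphereEmbedding.SmoothnessFacts] in
/-- **Discharge of `Knot.HasGaussDiagram.mirror`.** The mirror image of a knot has the mirrored
Gauss diagram, up to isotopy: given a regular projection `P` of `K` reading `G`, the knot
`K' = rot_π ∘ reflectLast 3 ∘ K` (reflection of `K` in the height coordinate of the projection) is
isotopic to `K.mirror = reflectLast 3 ∘ K` through the rotations `rot_{πt}` of `S³` in the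
`(x₂, x₃)`-plane (`SphereEmbedding.isIsotopic_map_halfTurn`), and the parameters of `P` form a
regular projection of `K'` reading `G.mirror` (`Knot.RegularProjection.hasGaussDiagram_mirrorTurn`).
Goussarov–Polyak–Viro (2000), §1.1, §1.4; Rolfsen (1976), §3.C; Kauffman (1987), Ch. II.
[cite: GPV2000, §1.1] [cite: Rolfsen1976, §3.C] -/
theorem HasGaussDiagram.mirror_holds : HasGaussDiagram.mirror := by
  rintro _ K G ⟨P, rfl⟩
  exact ⟨K.mirror.map halfTurn, SphereEmbedding.isIsotopic_map_halfTurn K.mirror,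
    P.hasGaussDiagram_mirrorTurn⟩

end Knot

end Literature.Topology.FourManifolds

end
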